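import Literature.IUT.LogThetaLattice.GlobalFrobenioidModelsPlaces
import Literature.IUT.LogThetaLattice.GlobalFrobenioidModelsCategory
import Literature.IUT.LogThetaLattice.GlobalKummerNonInterferenceProofs2
import Literature.NumberTheory.NumberFields.PlacesOfRingEquiv
import HarnessLib

/-!
# [IUTchIII] Ex. 3.6 / Rmk. 3.6.1 / Prop. 3.7 (i)(ii) / Prop. 3.10 (iii): the model global Frobenioid is a
# FUNCTOR of the number field — transport along ring isomorphisms, and Prop. 3.10 (iii) at the model

Bridge file (abc-iut cell, D-0067 wave 4, seat abc-iut-w4-d002; support of DISCHARGE-L6 rows F5/F10) over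
abc-iut-L6-t4's / -t6's `GlobalFrobenioidModels{,Category}.lean` ([IUTchIII] Ex. 3.6, kurims pp. 106–108),
abc-iut-L6-d1's `GlobalFrobenioidModelsPlaces.lean` (the MODEL place data `ModelPlaces F`, `betaModel`,
`nonnegModel` of Rmk. 3.6.1) and this seat's `GlobalKummerNonInterferenceProofs2.lean` (Prop. 3.10 (iii),
p. 149). S. Mochizuki, *Inter-universal Teichmüller theory III*, kurims manuscript (May 2020), §3 (claim key
Mochizuki2012, DISPUTED, D-0012). Nothing of the series is asserted; what is proved is classical transport
of structure along isomorphisms of number fields.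

THE POINT. Rmk. 3.6.1 (p. 108): the data `β_v`, `v ∈ 𝕍`, from which `𝓕⊛_MOD`/`𝓕⊛_𝔪𝔬𝔡` are built "are
completely determined by the ring structure of the field `F_mod`"; Prop. 3.7 (i)(ii) (pp. 109–110): "there
is an algorithm for constructing, as discussed in Example 3.6 …, from the [number] field … a Frobenioid";
Prop. 3.10 (i)/(iii) (pp. 147–149): the Kummer isomorphisms of number fields
`(^{n,m}𝕄⊛_MOD)_j ⥲ 𝕄⊛_MOD(^{n,∘}𝓗𝓣^𝒟)_j` "induce … isomorphisms of Frobenioids … mutually compatible … with the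
log-links" — Rmk. 3.10.1 (i): "precisely because the construction of '`(†𝓕⊛_MOD)_α`' only involves the group
'`(†𝕄⊛_MOD)_α`', together with the collection of subquotients of its perfection indexed by `𝕍`". The
statement-level discharge `VerticallyCoricGlobalData.prop310iii_frobenioids` /
`Prop310iii_compatible_of_functorialAlgorithm` (p411539) takes this FUNCTORIALITY of the construction in the
field as a NAMED hypothesis. HERE it is CONSTRUCTED and PROVED at the tree's model:

* §1 `FrakObj.reindex` / `reindexEquiv` — transport of Ex. 3.6 (ii) objects (finitely supported families of
  local classes) along a bijection of the index set of places; `refl`/`trans` laws; elementary morphisms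
  and morphisms (`IsElemHom`, `IsHom`) are preserved when the place data `(Γ^{≥0}_v, β_v)` correspond
  (`isElemHom_reindex_iff`, `isHom_reindex_iff`).
* §2 `placesEquiv σ : ModelPlaces K ≃ ModelPlaces K'` for `σ : K ≃+* K'` (finite places via `𝓞 K ≃+* 𝓞 K'`,
  archimedean places via `comap σ⁻¹`; classical input `Literature.NumberTheory.NumberFields.PlacesOfRingEquiv`,
  Cassels–Fröhlich VII §1.1), with `betaModel_placesEquiv : β_{σv}(σ f) = β_v(f)` and `nonnegModel_placesEquiv`
  — i.e. **Rmk. 3.6.1 ACROSS an isomorphism of number fields** (abc-iut-L6-d1's `remark361_determined_model`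
  is the automorphism case), and the `refl`/`trans`/`symm` laws.
* §3 `frakTransport σ` — the induced bijection of objects of the MODEL global Frobenioid of `K` and of `K'`
  (the Ex. 3.6 (ii) object type over `ModelPlaces`, `Γ_v = ℝ`), FUNCTORIAL (`frakTransport_trans`), preserving
  morphisms (`isHom_frakTransport_iff`); at universe `0` the honest functor of categories
  `frakCatTransport σ : 𝓕⊛_𝔪𝔬𝔡(K) ⥤ 𝓕⊛_𝔪𝔬𝔡(K')` on abc-iut-L6-t6's `FrakCat`.
* §4 **`prop310iii_model`** — [IUTchIII] Prop. 3.10 (iii) HOLDS UNCONDITIONALLY AT THE MODEL: for ANY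
  column of Kummer isomorphisms of number fields `κ_m : K_m ≃+* K_∘` (the data of Prop. 3.10 (i)), the
  induced bijections of model-Frobenioid objects are "mutually compatible, as `m` varies over the elements of
  `ℤ`, with the log-links", the log-link-induced maps being the transports along the log-Kummer field
  identifications `κ_{m+1}⁻¹ ∘ κ_m` — by `Prop310iii_compatible_of_functorialAlgorithm` with the functorial
  algorithm `frakTransport`; and these are the ONLY compatible log-link-induced maps (`…_lg_eq`).

HONEST SCOPE. (a) The object type used is the tree's REAL Ex. 3.6 (ii) type `FrakObj` over the MODEL place
data of the number field ITSELF (all places, `ord_v` / `−log|·|_v`): at a single Hodge theater this is the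
common object type of `𝓕⊛_mod ≅ 𝓕⊛_𝔪𝔬𝔡 ≅ 𝓕⊛_MOD` (Ex. 3.6 (i)–(iii); the torsor version `MODObj` is identified
with it by abc-iut-L6-t4's `FrakObj.toMOD`), built from the field ALONE — which is exactly the MOD-side /
"precise" situation of Rmk. 3.10.1 (i). It is NOT the `𝔪𝔬𝔡`-side construction of Prop. 3.7 (ii), whose
local fractional ideals are taken inside the log-shells `𝓘^ℚ(^{A,α}𝓕_v)` transported by log-links ("upper
semi-compatibility"): that construction is not functorial in the field alone and is not touched here.
(b) The Frobenioid STRUCTURE of [FrdI] Def. 1.3 on these categories is abc-iut-L6-t6's (`FrakCat`,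
`structureFunctor`); §3's functor is between their underlying categories. (c) Nothing here takes a side on
[IUTchIII] Cor. 3.12; typed ≠ discharged elsewhere; [claim: Mochizuki2012, status: disputed] for every
quoted sentence, the mathematics being transport of structure.
-/

noncomputable section

namespace Literature.IUT.LogThetaLattice

namespace GlobalFrobenioidModels

open NumberField IsDedekindDomain CategoryTheory
open Literature.NumberTheory.NumberFields

universe u v w

/-! ### §1 Reindexing Ex. 3.6 (ii) objects along a bijection of places -/

section Reindex

variable {V : Type u} {V' : Type v} {G : Type w} [AddCommGroup G]

/-- **Transport of an Ex. 3.6 (ii) object along a bijection of places** `e : 𝕍 ≃ 𝕍'`: the family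
`{𝔍_v}_v` becomes `{𝔍_{e⁻¹ v'}}_{v'}` (finite support is preserved). This is the object part of the functorial
algorithm "from the [number] field" of Prop. 3.7 (i)(ii) once `e` is the correspondence of places induced
by a field isomorphism (§2). ([IUTchIII] Ex 3.6 (ii) p.107; Prop 3.7 (i) p.109) [claim: Mochizuki2012, status: disputed] -/
def FrakObj.reindex (e : V ≃ V') (J : FrakObj V (fun _ => G)) : FrakObj V' (fun _ => G) where
  cls v' := J.cls (e.symm v')
  finite := J.finite.preimage e.symm.injective.injOn

/-- The classes of the transported object (definitional). ([IUTchIII] Ex 3.6 (ii) p.107) [claim: Mochizuki2012, status: disputed] -/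
@[simp] theorem FrakObj.reindex_cls (e : V ≃ V') (J : FrakObj V (fun _ => G)) (v' : V') :
    (J.reindex e).cls v' = J.cls (e.symm v') := rfl

/-- Transport along the identity bijection is the identity. ([IUTchIII] Ex 3.6 (ii) p.107) [claim: Mochizuki2012, status: disputed] -/
@[simp] theorem FrakObj.reindex_refl (J : FrakObj V (fun _ => G)) : J.reindex (Equiv.refl V) = J :=
  FrakObj.ext_cls rfl

/-- Transport along a composite bijection is the composite transport. ([IUTchIII] Ex 3.6 (ii) p.107)
[claim: Mochizuki2012, status: disputed] -/
theorem FrakObj.reindex_trans {V'' : Type*} (e : V ≃ V') (e' : V' ≃ V'') (J : FrakObj V (fun _ => G)) :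
    J.reindex (e.trans e') = (J.reindex e).reindex e' :=
  FrakObj.ext_cls rfl

/-- Transport along `e` and back along `e⁻¹` is the identity. ([IUTchIII] Ex 3.6 (ii) p.107) [claim: Mochizuki2012, status: disputed] -/
@[simp] theorem FrakObj.reindex_symm_reindex (e : V ≃ V') (J : FrakObj V (fun _ => G)) :
    (J.reindex e).reindex e.symm = J :=
  FrakObj.ext_cls (funext fun v => by simp)

/-- Transport along `e⁻¹` and then along `e` is the identity. ([IUTchIII] Ex 3.6 (ii) p.107) [claim: Mochizuki2012, status: disputed] -/
@[simp] theorem FrakObj.reindex_reindex_symm (e : V ≃ V') (J' : FrakObj V' (fun _ => G)) :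
    (J'.reindex e.symm).reindex e = J' :=
  FrakObj.ext_cls (funext fun v => by simp)

/-- **The bijection of Ex. 3.6 (ii) object types induced by a bijection of places.** ([IUTchIII] Ex 3.6 (ii)
p.107; Prop 3.7 (i) p.109) [claim: Mochizuki2012, status: disputed] -/
def FrakObj.reindexEquiv (e : V ≃ V') : FrakObj V (fun _ => G) ≃ FrakObj V' (fun _ => G) where
  toFun := FrakObj.reindex e
  invFun := FrakObj.reindex e.symm
  left_inv := FrakObj.reindex_symm_reindex e
  right_inv := FrakObj.reindex_reindex_symm e

/-- `reindexEquiv e J = J.reindex e` (definitional). ([IUTchIII] Ex 3.6 (ii) p.107) [claim: Mochizuki2012, status: disputed] -/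
@[simp] theorem FrakObj.reindexEquiv_apply (e : V ≃ V') (J : FrakObj V (fun _ => G)) :
    FrakObj.reindexEquiv e J = J.reindex e := rfl

/-- Tensor powers commute with transport. ([IUTchIII] Ex 3.6 (ii) p.107) [claim: Mochizuki2012, status: disputed] -/
@[simp] theorem FrakObj.reindex_tensorPow (e : V ≃ V') (J : FrakObj V (fun _ => G)) (n : ℤ) :
    (J.tensorPow n).reindex e = (J.reindex e).tensorPow n :=
  FrakObj.ext_cls rfl

variable {F : Type*} [Field F] {F' : Type*} [Field F']

/-- **Elementary morphisms are preserved by transport** along a field isomorphism `σ : F ≃+* F'` and a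
bijection of places `e` under which the local data correspond (`Γ^{≥0}_{e v} = Γ^{≥0}_v`,
`β_{e v}(σ f) = β_v(f)`): `f : 𝔍₁ → 𝔍₂` is an elementary morphism iff `σ f : e_*𝔍₁ → e_*𝔍₂` is.
([IUTchIII] Ex 3.6 (ii) p.107–108) [claim: Mochizuki2012, status: disputed] -/
theorem FrakObj.isElemHom_reindex_iff {nonneg : V → AddSubmonoid G} {nonneg' : V' → AddSubmonoid G}
    {β : V → (Additive Fˣ →+ G)} {β' : V' → (Additive F'ˣ →+ G)} (σ : F ≃+* F') (e : V ≃ V')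
    (hn : ∀ v, nonneg' (e v) = nonneg v)
    (hβ : ∀ v (f : Fˣ), β' (e v) (Additive.ofMul (Units.map (σ : F →* F') f)) = β v (Additive.ofMul f))
    (J₁ J₂ : FrakObj V (fun _ => G)) (f : Fˣ) :
    FrakObj.IsElemHom (nonneg := nonneg') (β := β') (J₁.reindex e) (J₂.reindex e)
        (Units.map (σ : F →* F') f) ↔
      FrakObj.IsElemHom (nonneg := nonneg) (β := β) J₁ J₂ f := by
  constructor
  · intro h v
    have hv := h (e v)
    rwa [FrakObj.reindex_cls, FrakObj.reindex_cls, Equiv.symm_apply_apply, hβ, hn] at hv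
  · intro h v'
    obtain ⟨v, rfl⟩ := e.surjective v'
    rw [FrakObj.reindex_cls, FrakObj.reindex_cls, Equiv.symm_apply_apply, hβ, hn]
    exact h v

/-- **Morphisms `(n, f)` are preserved by transport** (same hypotheses). ([IUTchIII] Ex 3.6 (ii) p.108)
[claim: Mochizuki2012, status: disputed] -/
theorem FrakObj.isHom_reindex_iff {nonneg : V → AddSubmonoid G} {nonneg' : V' → AddSubmonoid G}
    {β : V → (Additive Fˣ →+ G)} {β' : V' → (Additive F'ˣ →+ G)} (σ : F ≃+* F') (e : V ≃ V')
    (hn : ∀ v, nonneg' (e v) = nonneg v)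
    (hβ : ∀ v (f : Fˣ), β' (e v) (Additive.ofMul (Units.map (σ : F →* F') f)) = β v (Additive.ofMul f))
    (J₁ J₂ : FrakObj V (fun _ => G)) (n : ℕ+) (f : Fˣ) :
    FrakObj.IsHom (nonneg := nonneg') (β := β') (J₁.reindex e) (J₂.reindex e) n
        (Units.map (σ : F →* F') f) ↔
      FrakObj.IsHom (nonneg := nonneg) (β := β) J₁ J₂ n f := by
  unfold FrakObj.IsHom
  rw [← FrakObj.reindex_tensorPow]
  exact FrakObj.isElemHom_reindex_iff σ e hn hβ _ _ f

end Reindex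

/-! ### §2 Rmk. 3.6.1 across an isomorphism: the model place data of isomorphic number fields correspond -/

section Places

variable {K K' K'' : Type u} [Field K] [NumberField K] [Field K'] [NumberField K'] [Field K'']
  [NumberField K'']

/-- **The places of isomorphic number fields correspond**: `placesEquiv σ : 𝕍(K) ≃ 𝕍(K')` for
`σ : K ≃+* K'`, finite places through `𝓞 K ≃+* 𝓞 K'`, archimedean places through `comap σ⁻¹`
(Cassels–Fröhlich VII §1.1; tree file `PlacesOfRingEquiv`). This is the "completely determined by the ring
structure of the field" clause of [IUTchIII] Rmk. 3.6.1 (p. 108) read ACROSS an isomorphism of fields.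
([IUTchIII] Rmk 3.6.1 p.108) [claim: Mochizuki2012, status: disputed] -/
def placesEquiv (σ : K ≃+* K') : ModelPlaces K ≃ ModelPlaces K' :=
  (finitePlaceEquiv σ).sumCongr (infinitePlaceEquiv σ)

omit [NumberField K] [NumberField K'] in
/-- On finite places `placesEquiv` is `finitePlaceEquiv` (definitional). ([IUTchIII] Rmk 3.6.1 p.108)
[claim: Mochizuki2012, status: disputed] -/
@[simp] theorem placesEquiv_inl (σ : K ≃+* K') (w : HeightOneSpectrum (𝓞 K)) :
    placesEquiv σ (Sum.inl w) = Sum.inl (finitePlaceEquiv σ w) := rfl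

omit [NumberField K] [NumberField K'] in
/-- On archimedean places `placesEquiv` is `infinitePlaceEquiv` (definitional). ([IUTchIII] Rmk 3.6.1 p.108)
[claim: Mochizuki2012, status: disputed] -/
@[simp] theorem placesEquiv_inr (σ : K ≃+* K') (w : InfinitePlace K) :
    placesEquiv σ (Sum.inr w) = Sum.inr (infinitePlaceEquiv σ w) := rfl

omit [NumberField K] in
/-- Transport of places along the identity is the identity. ([IUTchIII] Rmk 3.6.1 p.108)
[claim: Mochizuki2012, status: disputed] -/
@[simp] theorem placesEquiv_refl : placesEquiv (RingEquiv.refl K) = Equiv.refl _ := by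
  rw [placesEquiv, finitePlaceEquiv_refl, infinitePlaceEquiv_refl, Equiv.sumCongr_refl]

omit [NumberField K] [NumberField K'] [NumberField K''] in
/-- Transport of places is compatible with composition of isomorphisms. ([IUTchIII] Rmk 3.6.1 p.108)
[claim: Mochizuki2012, status: disputed] -/
theorem placesEquiv_trans (σ : K ≃+* K') (τ : K' ≃+* K'') :
    placesEquiv (σ.trans τ) = (placesEquiv σ).trans (placesEquiv τ) := by
  rw [placesEquiv, placesEquiv, placesEquiv, finitePlaceEquiv_trans, infinitePlaceEquiv_trans,
    Equiv.sumCongr_trans]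

omit [NumberField K] [NumberField K'] in
/-- The inverse correspondence is transport along `σ⁻¹`. ([IUTchIII] Rmk 3.6.1 p.108)
[claim: Mochizuki2012, status: disputed] -/
@[simp] theorem placesEquiv_symm (σ : K ≃+* K') : (placesEquiv σ).symm = placesEquiv σ.symm := by
  rw [placesEquiv, placesEquiv, Equiv.sumCongr_symm, finitePlaceEquiv_symm, infinitePlaceEquiv_symm]

omit [NumberField K] [NumberField K'] in
/-- The cones of "nonnegative elements" correspond (both are `ℝ_{≥0}`). ([IUTchIII] Rmk 3.6.1 p.108)
[claim: Mochizuki2012, status: disputed] -/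
theorem nonnegModel_placesEquiv (σ : K ≃+* K') (v : ModelPlaces K) :
    nonnegModel (placesEquiv σ v) = nonnegModel v := rfl

/-- **Rmk. 3.6.1 across an isomorphism**: `β_{σ v}(σ f) = β_v(f)` — the homomorphisms `β_v` of Ex. 3.6
(`ord_v` at finite `v`, `−log |·|_v` at archimedean `v`) are transported along `σ : K ≃+* K'`
(Cassels–Fröhlich VII §1.1 `|σ a|_{σ w} = |a|_w`). ([IUTchIII] Rmk 3.6.1 p.108) [claim: Mochizuki2012, status: disputed] -/
theorem betaModel_placesEquiv (σ : K ≃+* K') (v : ModelPlaces K) (f : Kˣ) :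
    betaModel (placesEquiv σ v) (Additive.ofMul (Units.map (σ : K →* K') f)) =
      betaModel v (Additive.ofMul f) := by
  rcases v with w | w
  · show betaFin (finitePlaceEquiv σ w) _ = betaFin w _
    simp only [betaFin, AddMonoidHom.neg_apply, AddMonoidHom.coe_comp, Function.comp_apply,
      MonoidHom.coe_toAdditiveLeft, toMul_ofMul, valuationOfNeZero_finitePlaceEquiv]
  · show betaInf (infinitePlaceEquiv σ w) _ = betaInf w _
    simp only [betaInf, AddMonoidHom.coe_mk, ZeroHom.coe_mk, toMul_ofMul, Units.coe_map,
      MonoidHom.coe_coe, infinitePlaceEquiv_apply]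

/-- The Rmk. 3.6.1 subquotient datum is transported: `σ f` is "nonnegative" at `σ v` iff `f` is at `v`.
([IUTchIII] Rmk 3.6.1 p.108) [claim: Mochizuki2012, status: disputed] -/
theorem mem_datum_placesEquiv_iff (σ : K ≃+* K') (v : ModelPlaces K) (f : Kˣ) :
    Additive.ofMul (Units.map (σ : K →* K') f) ∈
        (Remark361_subquotientDatum (nonneg := nonnegModel) (β := betaModel) (placesEquiv σ v)).2 ↔
      Additive.ofMul f ∈ (Remark361_subquotientDatum (nonneg := nonnegModel) (β := betaModel) v).2 := by
  change _ ∈ (nonnegModel _).comap (betaModel _) ↔ _ ∈ (nonnegModel _).comap (betaModel _)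
  rw [AddSubmonoid.mem_comap, AddSubmonoid.mem_comap, betaModel_placesEquiv, nonnegModel_placesEquiv]

end Places

/-! ### §3 The functorial algorithm `K ↦ 𝓕⊛(K)` on objects and morphisms -/

section Transport

variable {K K' K'' : Type u} [Field K] [NumberField K] [Field K'] [NumberField K'] [Field K'']
  [NumberField K'']

/-- **Prop. 3.7 (i)/(ii) "algorithm … from the [number] field", functorial part**: the bijection between the
objects of the MODEL global Frobenioid of `K` (Ex. 3.6 (ii) objects over all places of `K`, `Γ_v = ℝ`) and
those of `K'` induced by `σ : K ≃+* K'`. ([IUTchIII] Prop 3.7 (i) p.109) [claim: Mochizuki2012, status: disputed] -/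
def frakTransport (σ : K ≃+* K') :
    FrakObj (ModelPlaces K) (fun _ => ℝ) ≃ FrakObj (ModelPlaces K') (fun _ => ℝ) :=
  FrakObj.reindexEquiv (placesEquiv σ)

omit [NumberField K] [NumberField K'] in
/-- `frakTransport σ J = J.reindex (placesEquiv σ)` (definitional). ([IUTchIII] Prop 3.7 (i) p.109)
[claim: Mochizuki2012, status: disputed] -/
@[simp] theorem frakTransport_apply (σ : K ≃+* K') (J : FrakObj (ModelPlaces K) (fun _ => ℝ)) :
    frakTransport σ J = J.reindex (placesEquiv σ) := rfl

omit [NumberField K] in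
/-- FUNCTORIALITY, identities: transport along `id` is the identity. ([IUTchIII] Prop 3.7 (i) p.109)
[claim: Mochizuki2012, status: disputed] -/
@[simp] theorem frakTransport_refl : frakTransport (RingEquiv.refl K) = Equiv.refl _ := by
  ext J : 1
  simp

omit [NumberField K] [NumberField K'] [NumberField K''] in
/-- **FUNCTORIALITY, composition**: transport along `σ` then `τ` is transport along `σ.trans τ` — the
hypothesis `hΦ` of `Prop310iii_compatible_of_functorialAlgorithm` for this algorithm.
([IUTchIII] Prop 3.7 (i) p.109; Rmk 3.10.1 (i) p.149) [claim: Mochizuki2012, status: disputed] -/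
theorem frakTransport_trans (σ : K ≃+* K') (τ : K' ≃+* K'') :
    frakTransport (σ.trans τ) = (frakTransport σ).trans (frakTransport τ) := by
  ext J : 1
  simp [placesEquiv_trans, FrakObj.reindex_trans]

omit [NumberField K] [NumberField K'] in
/-- FUNCTORIALITY, inverses: the inverse bijection is transport along `σ⁻¹`. ([IUTchIII] Prop 3.7 (i) p.109)
[claim: Mochizuki2012, status: disputed] -/
theorem frakTransport_symm (σ : K ≃+* K') : (frakTransport σ).symm = frakTransport σ.symm := by
  ext J : 1
  show J.reindex (placesEquiv σ).symm = J.reindex (placesEquiv σ.symm)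
  rw [placesEquiv_symm]

/-- **Morphisms are preserved**: `(n, f) : 𝔍₁ → 𝔍₂` is a morphism of the model global Frobenioid of `K` iff
`(n, σ f)` is one between the transported objects over `K'` (elementary morphisms = the case `n = 1`).
([IUTchIII] Ex 3.6 (ii) p.108; Prop 3.7 (i) p.109) [claim: Mochizuki2012, status: disputed] -/
theorem isHom_frakTransport_iff (σ : K ≃+* K') (J₁ J₂ : FrakObj (ModelPlaces K) (fun _ => ℝ)) (n : ℕ+)
    (f : Kˣ) :
    FrakObj.IsHom (nonneg := nonnegModel) (β := betaModel) (frakTransport σ J₁) (frakTransport σ J₂) n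
        (Units.map (σ : K →* K') f) ↔
      FrakObj.IsHom (nonneg := nonnegModel) (β := betaModel) J₁ J₂ n f :=
  FrakObj.isHom_reindex_iff σ (placesEquiv σ) (nonnegModel_placesEquiv σ) (betaModel_placesEquiv σ)
    J₁ J₂ n f

/-- Elementary morphisms are preserved (the case `n = 1`). ([IUTchIII] Ex 3.6 (ii) p.107–108)
[claim: Mochizuki2012, status: disputed] -/
theorem isElemHom_frakTransport_iff (σ : K ≃+* K') (J₁ J₂ : FrakObj (ModelPlaces K) (fun _ => ℝ))
    (f : Kˣ) :
    FrakObj.IsElemHom (nonneg := nonnegModel) (β := betaModel) (frakTransport σ J₁) (frakTransport σ J₂)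
        (Units.map (σ : K →* K') f) ↔
      FrakObj.IsElemHom (nonneg := nonnegModel) (β := betaModel) J₁ J₂ f :=
  FrakObj.isElemHom_reindex_iff σ (placesEquiv σ) (nonnegModel_placesEquiv σ) (betaModel_placesEquiv σ)
    J₁ J₂ f

end Transport

section CategoryLevel

variable {K K' : Type} [Field K] [NumberField K] [Field K'] [NumberField K']

/-- **The functor of categories `𝓕⊛_𝔪𝔬𝔡(K) ⥤ 𝓕⊛_𝔪𝔬𝔡(K')` induced by `σ : K ≃+* K'`** on abc-iut-L6-t6's
`FrakCat` (objects transported along the places, a morphism `(n, f)` sent to `(n, σ f)`); stated at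
universe `0`, where `FrakCat`'s single-universe signature admits the model value group `ℝ`. This is the
"Kummer isomorphism of Frobenioids induced by the Kummer isomorphism of fields" of Prop. 3.10 (i) at the
level of underlying categories. ([IUTchIII] Prop 3.7 (i) p.109; Prop 3.10 (i) p.148) [claim: Mochizuki2012, status: disputed] -/
def frakCatTransport (σ : K ≃+* K') :
    FrakCat K (ModelPlaces K) (fun _ => ℝ) nonnegModel betaModel ⥤
      FrakCat K' (ModelPlaces K') (fun _ => ℝ) nonnegModel betaModel where
  obj X := FrakCat.of (frakTransport σ X.obj)
  map {X Y} φ := FrakCat.homMk (FrakCat.deg φ) (Units.map (σ : K →* K') (FrakCat.fn φ))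
    ((isHom_frakTransport_iff σ X.obj Y.obj (FrakCat.deg φ) (FrakCat.fn φ)).mpr φ.isHom)
  map_id X := FrakCat.hom_ext rfl (by simp)
  map_comp φ ψ := FrakCat.hom_ext rfl (by simp [map_mul, map_pow])

/-- On objects the functor is `frakTransport`. ([IUTchIII] Prop 3.7 (i) p.109) [claim: Mochizuki2012, status: disputed] -/
@[simp] theorem frakCatTransport_obj (σ : K ≃+* K')
    (X : FrakCat K (ModelPlaces K) (fun _ => ℝ) nonnegModel betaModel) :
    ((frakCatTransport σ).obj X).obj = frakTransport σ X.obj := rfl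

end CategoryLevel

/-! ### §4 [IUTchIII] Prop. 3.10 (iii) at the model -/

section Prop310

variable {Kf : ℤ → Type u} [∀ m, Field (Kf m)] {Kc : Type u} [Field Kc]

/-- **[IUTchIII] Prop. 3.10 (iii), first display, AT THE MODEL — UNCONDITIONAL**: for ANY column of
Kummer isomorphisms of number fields `κ_m : K_m ⥲ K_∘` (`(^{n,m}𝕄⊛_MOD)_j ⥲ 𝕄⊛_MOD(^{n,∘}𝓗𝓣^𝒟)_j`, the data of
Prop. 3.10 (i)), the induced bijections `frakTransport (κ_m)` of model-global-Frobenioid objects are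
"mutually compatible, as `m` varies over the elements of `ℤ`, with the log-links" (`Prop310iii_compatible`),
the log-link-induced object maps being the transports along the log-Kummer field identifications
`κ_{m+1}⁻¹ ∘ κ_m` (Rmk. 3.10.1 (i): "precisely because the construction of '`(†𝓕⊛_MOD)_α`' only involves the
group '`(†𝕄⊛_MOD)_α`' …") — PROVED by instantiating `Prop310iii_compatible_of_functorialAlgorithm` (p411539)
with the functorial algorithm `frakTransport` (§3). (Stated for arbitrary fields `K_m`, `K_∘`; for number
fields the place data are the model data of Rmk. 3.6.1.) ([IUTchIII] Prop 3.10 (iii) p.149)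
[claim: Mochizuki2012, status: disputed] -/
theorem prop310iii_model (κ : ∀ m, Kf m ≃+* Kc) :
    Literature.IUT.LogThetaLattice.Prop310iii_compatible
      (fun m => FrakObj (ModelPlaces (Kf m)) (fun _ => ℝ))
      (fun m => frakTransport (κ m))
      (fun m => ⇑(frakTransport ((κ m).trans (κ (m + 1)).symm))) :=
  Prop310iii_compatible_of_functorialAlgorithm κ (fun m => FrakObj (ModelPlaces (Kf m)) (fun _ => ℝ))
    (FrakObj (ModelPlaces Kc) (fun _ => ℝ)) (fun _ σ => frakTransport σ) (fun _ σ => frakTransport σ)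
    fun _ σ τ => frakTransport_trans σ τ

/-- **… and rigidly so**: ANY family of log-link-induced object maps compatible with these Kummer
bijections IS the family of transports along `κ_{m+1}⁻¹ ∘ κ_m` (Rmk. 3.10.1 (ii)/(iv) "precise log-Kummer
correspondence … rigid", Fig. 3.2). ([IUTchIII] Prop 3.10 (iii) p.149; Rmk 3.10.1 (ii) p.150) [claim: Mochizuki2012, status: disputed] -/
theorem prop310iii_model_lg_eq (κ : ∀ m, Kf m ≃+* Kc)
    {lg : ∀ m, FrakObj (ModelPlaces (Kf m)) (fun _ => ℝ) → FrakObj (ModelPlaces (Kf (m + 1))) (fun _ => ℝ)}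
    (h : Literature.IUT.LogThetaLattice.Prop310iii_compatible
      (fun m => FrakObj (ModelPlaces (Kf m)) (fun _ => ℝ)) (fun m => frakTransport (κ m)) lg) (m : ℤ) :
    lg m = ⇑(frakTransport ((κ m).trans (κ (m + 1)).symm)) :=
  congrFun (h.lg_unique (prop310iii_model κ)) m

/-- The log-link-induced transport preserves morphisms of the model global Frobenioids (so the compatible
family of (iii) consists of isomorphisms of the underlying categories, not merely bijections of objects):
`(n, f)` is a morphism at `m` iff `(n, (κ_{m+1}⁻¹ ∘ κ_m) f)` is one at `m + 1`. ([IUTchIII] Prop 3.10 (iii) p.149)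
[claim: Mochizuki2012, status: disputed] -/
theorem prop310iii_model_isHom_iff [∀ m, NumberField (Kf m)] (κ : ∀ m, Kf m ≃+* Kc) (m : ℤ)
    (J₁ J₂ : FrakObj (ModelPlaces (Kf m)) (fun _ => ℝ)) (n : ℕ+) (f : (Kf m)ˣ) :
    FrakObj.IsHom (nonneg := nonnegModel) (β := betaModel)
        (frakTransport ((κ m).trans (κ (m + 1)).symm) J₁) (frakTransport ((κ m).trans (κ (m + 1)).symm) J₂)
        n (Units.map (((κ m).trans (κ (m + 1)).symm : Kf m ≃+* Kf (m + 1)) : Kf m →* Kf (m + 1)) f) ↔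
      FrakObj.IsHom (nonneg := nonnegModel) (β := betaModel) J₁ J₂ n f :=
  isHom_frakTransport_iff _ J₁ J₂ n f

end Prop310

end GlobalFrobenioidModels

end Literature.IUT.LogThetaLattice
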